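import Mathlib
import Summits.NavierStokesRegularity.NavierStokesRegularity.Theses.RootDecompPointVertex
import Summits.NavierStokesRegularity.NavierStokesRegularity.Theorems.ScenarioCensusSelfSimilarCone
import HarnessLib

/-!
# RootDecompPointVertex — glue `TypeIDssWall_of_calm_restless_high` (stmt-NavierStokesRegularity-31566) PROVED

Route N18 `route-NavierStokesRegularity-RootDecompPointVertex`, the GLUE of the RESTLESSNESS LADDER split of W
`TypeIDssWall` 29252 (lens-1 g8; writer evidence `GlueProofN18W.lean`, not mounted in this seat's jail — re-proved
here on the tree decls): `CalmSliceDssLiouville → RestlessDssLiouville → HighEnvelopeDssLiouville → TypeIDssWall`.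
W is by `Iff.rfl` the canonical `TypeIDSSLiouvilleConjecture`, which the tree's census dictionary
`ScenarioCensus.rdssClassEmpty_forall_iff_conjecture` reads as «every envelope class `RdssClassEmpty K` is empty»;
a member of the class with envelope `K` is either under the envelope 16 with a 1-calm KNSS-gauge slice (cell L), under
16 with no calm slice (cell Q), or not under 16 (cell Z, with `C₀ := K`). Pure logic over the tree dictionary;
Navier–Stokes regularity is NOT proved by anything here (rung 0).
-/

-- the summit and its single sub-problem share the name (CONVENTIONS §1), as in every Theorems file
set_option linter.dupNamespace false

namespace Summit.NavierStokesRegularity.NavierStokesRegularity.Theorems.PointVertex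

open Summit.NavierStokesRegularity.NavierStokesRegularity.Theses.RootDecompPointVertex

/-- **Glue of the restlessness ladder** (stmt-NavierStokesRegularity-31566): calm + restless + high cells ⟹ the
Type-I DSS wall, by the envelope-class dictionary and excluded middle on «under the envelope 16» and «has a
1-calm slice». [folklore] -/
theorem typeIDssWall_of_calm_restless_high_proof : TypeIDssWall_of_calm_restless_high := by
  unfold TypeIDssWall_of_calm_restless_high CalmSliceDssLiouville RestlessDssLiouville
    HighEnvelopeDssLiouville
  intro hL hQ hZ
  have hW : Summit.NavierStokesRegularity.NavierStokesRegularity.TypeIDSSLiouvilleConjecture := by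
    rw [← ScenarioCensus.rdssClassEmpty_forall_iff_conjecture]
    intro K
    rintro ⟨c, R, u, hc, hm, hme, hR, hd, hne⟩
    by_cases h16 : Literature.Analysis.FluidPDE.HasTypeIDecay 16 u
    · exact (Classical.em _).elim (fun h => hne (hL c R u hc hm hme hR h16 h))
        (fun h => hne (hQ c R u hc hm hme hR h16 h))
    · exact hne (hZ c R u hc hm hme hR ⟨K, hd⟩ h16)
  exact hW

/-- **Exactness of the restlessness ladder**: the wall ↔ calm ∧ restless ∧ high (each cell is the wall restricted to
its envelope/calmness class). [folklore] -/
theorem typeIDssWall_iff_cells :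
    TypeIDssWall ↔ CalmSliceDssLiouville ∧ RestlessDssLiouville ∧ HighEnvelopeDssLiouville := by
  constructor
  · intro hW
    have h : ∀ K : ℝ, ScenarioCensus.RdssClassEmpty K :=
      ScenarioCensus.rdssClassEmpty_forall_iff_conjecture.2 hW
    refine ⟨?_, ?_, ?_⟩
    · intro c R u hc hm hme hR hd _ 
      by_contra hne
      exact h 16 ⟨c, R, u, hc, hm, hme, hR, hd, hne⟩
    · intro c R u hc hm hme hR hd _
      by_contra hne
      exact h 16 ⟨c, R, u, hc, hm, hme, hR, hd, hne⟩
    · rintro c R u hc hm hme hR ⟨C₀, hC₀⟩ _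
      by_contra hne
      exact h C₀ ⟨c, R, u, hc, hm, hme, hR, hC₀, hne⟩
  · rintro ⟨hL, hQ, hZ⟩
    exact typeIDssWall_of_calm_restless_high_proof hL hQ hZ

end Summit.NavierStokesRegularity.NavierStokesRegularity.Theorems.PointVertex
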